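import Mathlib
import Literature.NumberTheory.LFunctions.KloostermanPrimePower
import Literature.NumberTheory.LFunctions.KloostermanPrimePowerTools
import Literature.NumberTheory.LFunctions.Zhang2022.KnifeEdgeLenZDegreeKloosterman

/-!
LANDING NOTE (typer ls-idea-typ-1 gen 2, cell ls-idea, 2026-08-28): authored by seat ls-idea-lens-6 gen 7
(SKETCH #9 v3 `HOME/ls-idea-lens-6/Sketch_K612_GaussWeightLaw.lean` sha16 a415d31dfefc02ce, 308 l.,
`lean check` rc 0, 18 decls all PROVED; card K6-12 ◆ §v9 + §v10c; critics A b51/b54/b62 PASS law-grade ·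
B b56/b62–b63 PASS (BN-14 W-BG at prime level RETRACTED on this law) · C b52/b55/b65 PASS). Landed VERBATIM
as a Literature file (topic `Literature/NumberTheory/LFunctions`, namespace `…KloostermanSectors`; cite
tags added). Finite-sum identities about Kloosterman sums at ONE prime modulus; nothing about the door.

# Sketch (ls-idea lens-6, K6-12 ◆ «GAUSS-WEIGHT LAW», cards/ls-idea-lens-6.md §v9 l.315–330) —
# the kernel-checkable core of (G)/(C′): sector decomposition of a bilinear Kloosterman form at
# ONE prime modulus, and the weight `1/(p−1)` of its PRINCIPAL sector against `p/(p−1)`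

Typing offer for ls-idea-typ-1 (author's sketch).  Everything in this file is PROVED (no
`sorry`); it is an identity about finite sums and proves nothing about the door.
LOCATOR FOUND WHILE TYPING (search-before-claim, 2026-08-28): the one-variable identity (G)
`S(a,1;p) = (p−1)⁻¹ Σ_θ θ(ā) τ(θ)²` and the weight count «principal `1`, non-principal `p`» are
ALREADY IN THE TREE — `Literature.NumberTheory.LFunctions.Zhang2022.KnifeEdge.`
`sum_char_inv_mul_gaussSum_sq`, `kloostermanSum_eq_inv_mul_sum_char`, `norm_gaussSum_sq_of_ne_one`,
`norm_char_inv_mul_gaussSum_sq` (M-RULEBOOK §5′ (E4.z′) of route `ZDegreeToeplitzBand`; cites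
MontgomeryVaughan2007 Cor 4.5 (4.15) / Thm 9.7) — so they are CITED below, not restated
(typer lint rule).  What this file adds is the form in which K6-12 uses them:

* `kloostermanSum_eq_inv_mul_sum_char₂` — two variables: `S(m,n;p) = (p−1)⁻¹ Σ_θ θ((mn)⁻¹) τ(θ)²`;
* `bilinearKloosterman_eq_sum_sectors` — for ARBITRARY coefficient tables `α β : ZMod p → ℂ`
  the bilinear form `Σ_{m,n ≢ 0} α(m) β(n) S(m,n;p)` is `(p−1)⁻¹ Σ_θ sector α β θ`,
  `sector α β θ = τ(θ)² (Σ_m α(m) θ(m⁻¹)) (Σ_n β(n) θ(n⁻¹))` — one term per character mod `p`;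
* `sector_one`, `norm_gaussSum_one_sq`, `norm_sector_one_le` — the PRINCIPAL sector is
  `τ(θ₀)² (Σ_{m≢0} α(m)) (Σ_{n≢0} β(n))` with `‖τ(θ₀)²‖ = 1`, so
  `‖principal sector‖ ≤ ‖α‖₁ ‖β‖₁` (times the common `(p−1)⁻¹`), whereas
* `norm_sector_of_ne_one` — every NON-principal sector is `p · ‖Σ α θ̄‖ · ‖Σ β θ̄‖`;
* `jointSector`, `bilinearKloosterman_eq_sum_jointSectors`, `norm_jointSector_one_le` — the same for a
  JOINT coefficient table `Φ(m,n)` (the shape of the layers `c = qk`, `(k,q)=1`, after twisted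
  multiplicativity, with `Φ(m,n) = α(m)β(n)S(q̄m,q̄n;k)`, `‖Φ‖₁ ≤ k‖α‖₁‖β‖₁`).
* `sum_char_mul_char_inv`, `sector_charTable`, `bilinearKloosterman_charTable`,
  `norm_bilinearKloosterman_charTable` — TIGHTNESS: the complete character table `α = β = θ₀ ≠ θ₀⁰`
  gives `Σ_{m,n≢0} θ₀(m)θ₀(n)S(m,n;p) = (p−1)τ(θ₀)²` of norm `p(p−1) = p‖α‖₂‖β‖₂` — the non-principal
  weight `p` of (G) is ATTAINED by a generic complete table, so a saving beyond Parseval at one prime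
  modulus must come from the arithmetic structure of the coefficients (barrier note BN-7a's content).

K6-12 reading: the UNTWISTED pairing `(Σ α)(Σ β)` of the coefficients — the only place the
untwisted mollifier square `M_x(½+s)²` can enter the `c = q` Petersson term — carries relative
weight `1/p` below each conductor-`p` member; with `‖α‖₁ ≍ x^{1/2} log x` (`α(m) = A(m) m^{−1/2}`,
`A` the Möbius autoconvolution of length `x = q̂^{2Δ′}`) and `‖β‖₁ ≍ q^{(1+ε)/2}`
(`β(n) = τ_V(n) n^{−1/2}`, `n ≲ q^{1+ε}`) this is the card's «`E_q^{(0)} ≤ MAIN·q̂^{Δ′−3+ε}`»;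
that exponent count (and the Bessel factor `|J₁| ≤ 0.68`) stays pencil — docstring only.

HONESTY: finite-sum identities; no statement about `MomentsBeyondDiagonal` / K_A, no
exceptional-zero exclusion, not Theorem 1–2 of arXiv:2211.02515; typed-and-proved here ≠ the door.
-/

open Finset DirichletCharacter

namespace Literature.NumberTheory.LFunctions.KloostermanSectors

open Literature.NumberTheory.LFunctions (kloostermanSum kloostermanSum_eq_one_mul)
open Literature.NumberTheory.LFunctions.Zhang2022.KnifeEdge

variable {p : ℕ} [Fact p.Prime]

/-- shorthand: `τ(θ) = Σ_x θ(x) e(x/p)` (Mathlib `gaussSum θ ZMod.stdAddChar`). [cite: MontgomeryVaughan2007, §9.2 (the Gauss sum τ(χ))] -/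
noncomputable abbrev τ (θ : DirichletCharacter ℂ p) : ℂ := gaussSum θ (ZMod.stdAddChar (N := p))

/-- (G), two variables: `S(m,n;p) = (p−1)⁻¹ Σ_θ θ((mn)⁻¹) τ(θ)²` for `m, n ≢ 0 (mod p)` — from the
tree's one-variable form via `S(m,n;p) = S(1,mn;p) = S(mn,1;p)`.
[cite: MontgomeryVaughan2007, Cor 4.5 (4.15)] -/
theorem kloostermanSum_eq_inv_mul_sum_char₂ {m n : ZMod p} (hm : m ≠ 0) (hn : n ≠ 0) :
    kloostermanSum p m n =
      ((p : ℂ) - 1)⁻¹ * ∑ θ : DirichletCharacter ℂ p, θ (m * n)⁻¹ * τ θ ^ 2 := by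
  rw [kloostermanSum_eq_one_mul (isUnit_iff_ne_zero.2 hm),
    Literature.NumberTheory.LFunctions.kloostermanSum_comm,
    kloostermanSum_eq_inv_mul_sum_char (mul_ne_zero hm hn)]

/-- the `θ`-SECTOR of the bilinear form with coefficient tables `α, β`:
`τ(θ)² · (Σ_m α(m) θ(m⁻¹)) · (Σ_n β(n) θ(n⁻¹))` (the terms `m = 0`, `n = 0` vanish). [cite: MontgomeryVaughan2007, Cor 4.5 (4.15)] -/
noncomputable def sector (α β : ZMod p → ℂ) (θ : DirichletCharacter ℂ p) : ℂ :=
  τ θ ^ 2 * (∑ m : ZMod p, α m * θ m⁻¹) * (∑ n : ZMod p, β n * θ n⁻¹)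

/-- a character vanishes at `0⁻¹ = 0`. [folklore] -/
private theorem char_inv_zero (θ : DirichletCharacter ℂ p) : θ (0 : ZMod p)⁻¹ = 0 := by
  rw [inv_zero]
  exact θ.map_nonunit (by simp)

/-- a twisted coefficient sum over all residues is the sum over the non-zero ones. [folklore] -/
private theorem sum_mul_char_inv_eq_sum_erase (γ : ZMod p → ℂ) (θ : DirichletCharacter ℂ p) :
    ∑ m : ZMod p, γ m * θ m⁻¹ = ∑ m ∈ (univ : Finset (ZMod p)).erase 0, γ m * θ m⁻¹ := by
  rw [← Finset.sum_erase (univ : Finset (ZMod p)) (a := 0)]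
  rw [char_inv_zero, mul_zero]

/-- **SECTOR DECOMPOSITION** of a bilinear Kloosterman form at one prime modulus:
`Σ_{m ≢ 0} Σ_{n ≢ 0} α(m) β(n) S(m,n;p) = (p−1)⁻¹ Σ_{θ mod p} sector α β θ`, for arbitrary
coefficients. [cite: MontgomeryVaughan2007, Cor 4.5 (4.15)] -/
theorem bilinearKloosterman_eq_sum_sectors (α β : ZMod p → ℂ) :
    ∑ m ∈ (univ : Finset (ZMod p)).erase 0, ∑ n ∈ (univ : Finset (ZMod p)).erase 0,
        α m * β n * kloostermanSum p m n =
      ((p : ℂ) - 1)⁻¹ * ∑ θ : DirichletCharacter ℂ p, sector α β θ := by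
  classical
  set E : Finset (ZMod p) := (univ : Finset (ZMod p)).erase 0 with hE
  set c : ℂ := ((p : ℂ) - 1)⁻¹ with hc
  -- each Kloosterman sum by (G)
  have h1 : ∀ m ∈ E, ∀ n ∈ E, α m * β n * kloostermanSum p m n =
      ∑ θ : DirichletCharacter ℂ p, c * (τ θ ^ 2 * (α m * θ m⁻¹) * (β n * θ n⁻¹)) := by
    intro m hm n hn
    rw [kloostermanSum_eq_inv_mul_sum_char₂ (mem_erase.1 hm).1 (mem_erase.1 hn).1, Finset.mul_sum,
      Finset.mul_sum]
    refine Finset.sum_congr rfl fun θ _ => ?_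
    rw [mul_inv, map_mul]
    ring
  calc ∑ m ∈ E, ∑ n ∈ E, α m * β n * kloostermanSum p m n
      = ∑ m ∈ E, ∑ n ∈ E, ∑ θ : DirichletCharacter ℂ p,
          c * (τ θ ^ 2 * (α m * θ m⁻¹) * (β n * θ n⁻¹)) :=
        Finset.sum_congr rfl fun m hm => Finset.sum_congr rfl fun n hn => h1 m hm n hn
    _ = ∑ m ∈ E, ∑ θ : DirichletCharacter ℂ p, ∑ n ∈ E,
          c * (τ θ ^ 2 * (α m * θ m⁻¹) * (β n * θ n⁻¹)) :=
        Finset.sum_congr rfl fun m _ => Finset.sum_comm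
    _ = ∑ θ : DirichletCharacter ℂ p, ∑ m ∈ E, ∑ n ∈ E,
          c * (τ θ ^ 2 * (α m * θ m⁻¹) * (β n * θ n⁻¹)) := Finset.sum_comm
    _ = ∑ θ : DirichletCharacter ℂ p, c * sector α β θ := by
        refine Finset.sum_congr rfl fun θ _ => ?_
        rw [sector, sum_mul_char_inv_eq_sum_erase α θ, sum_mul_char_inv_eq_sum_erase β θ,
          mul_assoc, Finset.sum_mul_sum]
        simp only [Finset.mul_sum]
        refine Finset.sum_congr rfl fun m _ => Finset.sum_congr rfl fun n _ => ?_
        ring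
    _ = c * ∑ θ : DirichletCharacter ℂ p, sector α β θ := by rw [Finset.mul_sum]

/-- the trivial character is `1` at `m⁻¹` for `m ≢ 0`. [folklore] -/
private theorem one_apply_inv {m : ZMod p} (hm : m ≠ 0) : (1 : DirichletCharacter ℂ p) m⁻¹ = 1 :=
  MulChar.one_apply (isUnit_iff_ne_zero.2 (inv_ne_zero hm))

/-- **THE PRINCIPAL SECTOR** `θ = θ₀`: `sector α β θ₀ = τ(θ₀)² (Σ_{m≢0} α(m)) (Σ_{n≢0} β(n))` —
the UNTWISTED pairing of the two coefficient tables. [cite: MontgomeryVaughan2007, Cor 4.5 (4.15)] -/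
theorem sector_one (α β : ZMod p → ℂ) :
    sector α β 1 = τ (1 : DirichletCharacter ℂ p) ^ 2 *
      (∑ m ∈ (univ : Finset (ZMod p)).erase 0, α m) *
        (∑ n ∈ (univ : Finset (ZMod p)).erase 0, β n) := by
  have h : ∀ γ : ZMod p → ℂ, ∑ m : ZMod p, γ m * (1 : DirichletCharacter ℂ p) m⁻¹ =
      ∑ m ∈ (univ : Finset (ZMod p)).erase 0, γ m := by
    intro γ
    rw [sum_mul_char_inv_eq_sum_erase]
    refine Finset.sum_congr rfl fun m hm => ?_
    rw [one_apply_inv (mem_erase.1 hm).1, mul_one]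
  rw [sector, h α, h β]

/-- **principal weight** `‖τ(θ₀)²‖ = 1` (`τ(θ₀) = Σ_{x≢0} e(x/p) = −1 = μ(p)`), against
`‖τ(θ)²‖ = p` for `θ ≠ θ₀` (tree: `norm_gaussSum_sq_of_ne_one`).
[cite: MontgomeryVaughan2007, Thm 9.7] -/
theorem norm_gaussSum_one_sq : ‖τ (1 : DirichletCharacter ℂ p) ^ 2‖ = 1 := by
  have h := norm_char_inv_mul_gaussSum_sq (θ := (1 : DirichletCharacter ℂ p)) (a := (1 : ZMod p))
    one_ne_zero
  rw [if_pos rfl, norm_mul, one_apply_inv one_ne_zero, norm_one, one_mul] at h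
  exact h

/-- **PRINCIPAL SECTOR BOUND** (K6-12 (G): «trivially, no cancellation used, any zero-world»):
`‖sector α β θ₀‖ ≤ (Σ_{m≢0} ‖α(m)‖)(Σ_{n≢0} ‖β(n)‖)` — so inside
`(p−1)⁻¹ Σ_θ sector` the untwisted pairing weighs `≤ ‖α‖₁‖β‖₁/(p−1)`.
[cite: MontgomeryVaughan2007, Thm 9.7] -/
theorem norm_sector_one_le (α β : ZMod p → ℂ) :
    ‖sector α β 1‖ ≤ (∑ m ∈ (univ : Finset (ZMod p)).erase 0, ‖α m‖) *
      (∑ n ∈ (univ : Finset (ZMod p)).erase 0, ‖β n‖) := by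
  rw [sector_one, norm_mul, norm_mul, norm_gaussSum_one_sq, one_mul]
  exact mul_le_mul (norm_sum_le _ _) (norm_sum_le _ _) (norm_nonneg _)
    (Finset.sum_nonneg fun _ _ => norm_nonneg _)

/-- **NON-PRINCIPAL SECTORS**: for `θ ≠ θ₀`, `‖sector α β θ‖ = p · ‖Σ_m α(m)θ(m⁻¹)‖ · ‖Σ_n β(n)θ(n⁻¹)‖`
— each conductor-`p` member enters with weight `p`, i.e. `p` times the principal one.
[cite: MontgomeryVaughan2007, Thm 9.7] -/
theorem norm_sector_of_ne_one (α β : ZMod p → ℂ) {θ : DirichletCharacter ℂ p} (hθ : θ ≠ 1) :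
    ‖sector α β θ‖ = (p : ℝ) * ‖∑ m : ZMod p, α m * θ m⁻¹‖ * ‖∑ n : ZMod p, β n * θ n⁻¹‖ := by
  rw [sector, norm_mul, norm_mul, norm_pow, norm_gaussSum_sq_of_ne_one hθ]

/-! ### Joint coefficients (the form needed for the layers `c = qk`, `(k,q) = 1`)

By twisted multiplicativity `S(m,n;qk) = S(k̄m,k̄n;q)·S(q̄m,q̄n;k)` (tree:
`Literature.NumberTheory.LFunctions.kloostermanSum_mul_of_coprime`, IK (1.59)) the `c = qk` layer
is a bilinear Kloosterman form mod `q` whose coefficient `Φ(m,n) = α(m)β(n)S(q̄m,q̄n;k)` no longer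
separates; the sector decomposition survives verbatim for a JOINT table `Φ`, and the principal
sector is bounded by `‖Φ‖₁ ≤ k·‖α‖₁‖β‖₁` (`|S(·,·;k)| ≤ k`, tree: `norm_kloostermanSum_le`) —
K6-12 (G)'s «χ₀-mod-q ⊗ anything-mod-k sector ≤ Σ_k MAIN·q̂^{Δ′−3+ε}·(k-weight)».  The
push-forward of integer-indexed sums to residues mod `q` is bookkeeping left to the typer. -/

/-- joint `θ`-sector: `τ(θ)² Σ_{m,n} Φ(m,n) θ((mn)⁻¹)`. [cite: MontgomeryVaughan2007, Cor 4.5 (4.15)] -/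
noncomputable def jointSector (Φ : ZMod p → ZMod p → ℂ) (θ : DirichletCharacter ℂ p) : ℂ :=
  τ θ ^ 2 * ∑ m : ZMod p, ∑ n : ZMod p, Φ m n * θ (m * n)⁻¹

/-- **SECTOR DECOMPOSITION, joint coefficients:**
`Σ_{m,n ≢ 0} Φ(m,n) S(m,n;p) = (p−1)⁻¹ Σ_θ jointSector Φ θ`. [cite: MontgomeryVaughan2007, Cor 4.5 (4.15)] -/
theorem bilinearKloosterman_eq_sum_jointSectors (Φ : ZMod p → ZMod p → ℂ) :
    ∑ m ∈ (univ : Finset (ZMod p)).erase 0, ∑ n ∈ (univ : Finset (ZMod p)).erase 0,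
        Φ m n * kloostermanSum p m n =
      ((p : ℂ) - 1)⁻¹ * ∑ θ : DirichletCharacter ℂ p, jointSector Φ θ := by
  classical
  set E : Finset (ZMod p) := (univ : Finset (ZMod p)).erase 0 with hE
  set c : ℂ := ((p : ℂ) - 1)⁻¹ with hc
  have h1 : ∀ m ∈ E, ∀ n ∈ E, Φ m n * kloostermanSum p m n =
      ∑ θ : DirichletCharacter ℂ p, c * (τ θ ^ 2 * (Φ m n * θ (m * n)⁻¹)) := by
    intro m hm n hn
    rw [kloostermanSum_eq_inv_mul_sum_char₂ (mem_erase.1 hm).1 (mem_erase.1 hn).1, Finset.mul_sum,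
      Finset.mul_sum]
    refine Finset.sum_congr rfl fun θ _ => ?_
    ring
  -- the character kills `m = 0` or `n = 0`, so the sums over `E` are sums over everything
  have h0 : ∀ (θ : DirichletCharacter ℂ p) (m n : ZMod p), m = 0 ∨ n = 0 →
      Φ m n * θ (m * n)⁻¹ = 0 := by
    intro θ m n h
    rcases h with h | h
    · rw [h, zero_mul, char_inv_zero, mul_zero]
    · rw [h, mul_zero, char_inv_zero, mul_zero]
  have h2 : ∀ θ : DirichletCharacter ℂ p,
      ∑ m ∈ E, ∑ n ∈ E, Φ m n * θ (m * n)⁻¹ = ∑ m : ZMod p, ∑ n : ZMod p, Φ m n * θ (m * n)⁻¹ := by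
    intro θ
    rw [← Finset.sum_erase (univ : Finset (ZMod p)) (a := 0)]
    · refine Finset.sum_congr rfl fun m _ => ?_
      rw [← Finset.sum_erase (univ : Finset (ZMod p)) (a := 0)]
      exact h0 θ m 0 (Or.inr rfl)
    · exact Finset.sum_eq_zero fun n _ => h0 θ 0 n (Or.inl rfl)
  calc ∑ m ∈ E, ∑ n ∈ E, Φ m n * kloostermanSum p m n
      = ∑ m ∈ E, ∑ n ∈ E, ∑ θ : DirichletCharacter ℂ p, c * (τ θ ^ 2 * (Φ m n * θ (m * n)⁻¹)) :=
        Finset.sum_congr rfl fun m hm => Finset.sum_congr rfl fun n hn => h1 m hm n hn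
    _ = ∑ m ∈ E, ∑ θ : DirichletCharacter ℂ p, ∑ n ∈ E, c * (τ θ ^ 2 * (Φ m n * θ (m * n)⁻¹)) :=
        Finset.sum_congr rfl fun m _ => Finset.sum_comm
    _ = ∑ θ : DirichletCharacter ℂ p, ∑ m ∈ E, ∑ n ∈ E, c * (τ θ ^ 2 * (Φ m n * θ (m * n)⁻¹)) :=
        Finset.sum_comm
    _ = ∑ θ : DirichletCharacter ℂ p, c * jointSector Φ θ := by
        refine Finset.sum_congr rfl fun θ _ => ?_
        rw [jointSector, ← h2 θ]
        simp only [Finset.mul_sum]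
    _ = c * ∑ θ : DirichletCharacter ℂ p, jointSector Φ θ := by rw [Finset.mul_sum]

/-- **principal joint sector**: `jointSector Φ θ₀ = τ(θ₀)² Σ_{m,n ≢ 0} Φ(m,n)` and hence
`‖jointSector Φ θ₀‖ ≤ Σ_{m,n} ‖Φ(m,n)‖` (untwisted, no cancellation, any zero-world).
[cite: MontgomeryVaughan2007, Thm 9.7] -/
theorem norm_jointSector_one_le (Φ : ZMod p → ZMod p → ℂ) :
    ‖jointSector Φ 1‖ ≤ ∑ m : ZMod p, ∑ n : ZMod p, ‖Φ m n‖ := by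
  rw [jointSector, norm_mul, norm_gaussSum_one_sq, one_mul]
  refine (norm_sum_le _ _).trans (Finset.sum_le_sum fun m _ => ?_)
  refine (norm_sum_le _ _).trans (Finset.sum_le_sum fun n _ => ?_)
  rw [norm_mul]
  by_cases h : IsUnit (m * n)⁻¹
  · rw [MulChar.one_apply h, norm_one, mul_one]
  · rw [MulChar.map_nonunit _ h, norm_zero, mul_zero]
    exact norm_nonneg _

/-! ### Tightness: character tables ATTAIN the non-principal weight (why BN-7a is about structure)

For a fixed non-principal `θ₀` take the complete tables `α = β = θ₀` (as functions on `ZMod p`).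
Then every sector vanishes except `θ = θ₀`, which equals `τ(θ₀)²(p−1)²`; hence
`Σ_{m,n ≢ 0} θ₀(m)θ₀(n) S(m,n;p) = (p−1)·τ(θ₀)²` of norm `p(p−1) = p·‖α‖₂‖β‖₂`: the Parseval-type
bound `‖α‖₁‖β‖₁/(p−1) + p‖α‖₂‖β‖₂` is attained to leading order by a GENERIC complete table.  So any
saving beyond Parseval at ONE prime modulus must use the arithmetic structure of the coefficients
(`μP∗μP ⊗ τ_V`), never table-generic bilinear technology — the content of barrier note BN-7a. -/

/-- Orthogonality in the form used by the tightness witness: `Σ_m θ₀(m) θ(m⁻¹) = (p−1)·[θ = θ₀]`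
(sum over all residues mod `p`; the term `m = 0` vanishes). [cite: MontgomeryVaughan2007, Cor 4.5 (orthogonality relations (4.13)–(4.15))] -/
theorem sum_char_mul_char_inv (θ₀ θ : DirichletCharacter ℂ p) :
    ∑ m : ZMod p, θ₀ m * θ m⁻¹ = if θ = θ₀ then ((p : ℂ) - 1) else 0 := by
  classical
  have key : ∀ m : ZMod p, θ₀ m * θ m⁻¹ = (θ₀ * θ⁻¹) m := by
    intro m
    rw [MulChar.mul_apply, MulChar.inv_apply']
  simp_rw [key]
  split_ifs with h
  · subst h
    rw [mul_inv_cancel, MulChar.sum_one_eq_card_units, ZMod.card_units_eq_totient,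
      Nat.totient_prime (Fact.out : p.Prime)]
    have hp : 1 ≤ p := (Fact.out : p.Prime).one_lt.le
    push_cast [Nat.cast_sub hp]
    ring
  · apply MulChar.sum_eq_zero_of_ne_one
    intro h1
    apply h
    have h2 := congrArg (· * θ) h1
    simp only [mul_assoc, inv_mul_cancel, mul_one, one_mul] at h2
    exact h2.symm

/-- the sectors of the character table `α = β = θ₀`: only `θ = θ₀` survives (orthogonality).
[cite: MontgomeryVaughan2007, Cor 4.5 (4.13)–(4.15)] -/
theorem sector_charTable (θ₀ θ : DirichletCharacter ℂ p) :
    sector (fun m => θ₀ m) (fun n => θ₀ n) θ =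
      if θ = θ₀ then τ θ₀ ^ 2 * ((p : ℂ) - 1) ^ 2 else 0 := by
  rw [sector, sum_char_mul_char_inv]
  split_ifs with h
  · subst h; ring
  · ring

/-- **TIGHTNESS WITNESS:** `Σ_{m,n ≢ 0} θ₀(m) θ₀(n) S(m,n;p) = (p−1)·τ(θ₀)²`. [cite: MontgomeryVaughan2007, Cor 4.5 (4.15) and Thm 9.7] -/
theorem bilinearKloosterman_charTable (θ₀ : DirichletCharacter ℂ p) :
    ∑ m ∈ (univ : Finset (ZMod p)).erase 0, ∑ n ∈ (univ : Finset (ZMod p)).erase 0,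
        θ₀ m * θ₀ n * kloostermanSum p m n = ((p : ℂ) - 1) * τ θ₀ ^ 2 := by
  classical
  rw [bilinearKloosterman_eq_sum_sectors (fun m => θ₀ m) (fun n => θ₀ n)]
  simp_rw [sector_charTable θ₀]
  rw [Finset.sum_ite_eq' univ θ₀, if_pos (mem_univ _)]
  have hp1 : ((p : ℂ) - 1) ≠ 0 := by
    have : (p : ℂ) ≠ 1 := by exact_mod_cast (Fact.out : p.Prime).one_lt.ne'
    exact sub_ne_zero.2 this
  calc ((p : ℂ) - 1)⁻¹ * (τ θ₀ ^ 2 * ((p : ℂ) - 1) ^ 2)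
      = ((p : ℂ) - 1)⁻¹ * ((p : ℂ) - 1) * (((p : ℂ) - 1) * τ θ₀ ^ 2) := by ring
    _ = ((p : ℂ) - 1) * τ θ₀ ^ 2 := by rw [inv_mul_cancel₀ hp1, one_mul]

/-- … and its norm is `p·(p−1)` for `θ₀ ≠ θ₀⁰`: the non-principal weight `p` of the law (G) is
ATTAINED by a complete generic table (`‖α‖₂² = ‖β‖₂² = p − 1`). [cite: MontgomeryVaughan2007, Thm 9.7 (|τ(χ)|² = q for primitive χ)] -/
theorem norm_bilinearKloosterman_charTable {θ₀ : DirichletCharacter ℂ p} (hθ₀ : θ₀ ≠ 1) :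
    ‖∑ m ∈ (univ : Finset (ZMod p)).erase 0, ∑ n ∈ (univ : Finset (ZMod p)).erase 0,
        θ₀ m * θ₀ n * kloostermanSum p m n‖ = (p : ℝ) * ((p : ℝ) - 1) := by
  rw [bilinearKloosterman_charTable, norm_mul, norm_pow, norm_gaussSum_sq_of_ne_one hθ₀]
  have hp : (1 : ℝ) ≤ (p : ℝ) := by exact_mod_cast (Fact.out : p.Prime).one_lt.le
  have : ‖((p : ℂ) - 1)‖ = (p : ℝ) - 1 := by
    rw [show ((p : ℂ) - 1) = (((p : ℝ) - 1 : ℝ) : ℂ) by push_cast; ring, Complex.norm_real,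
      Real.norm_eq_abs, abs_of_nonneg (by linarith)]
  rw [this]
  ring

end Literature.NumberTheory.LFunctions.KloostermanSectors
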